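import Summits.BirchSwinnertonDyer.Rank1Residual.Additive.PotSupersingularTargets
import Summits.BirchSwinnertonDyer.Rank1Residual.Additive.WildThreeRefinedKolyvagin
import HarnessLib
import HarnessLib.Audit.Tags

/-!
# UI-O6 — pocket O6 (WILD additive reduction at `3`): ONE conjectural statement for the `3`-part

Cell `bsd-uniform`, seat `ui-o6` (explicit units `bsd-uniform-ui-o6-g0`, `-g1`); companion note
`pub/bsd-uniform/ui/O6-CONJECTURE.md` (census description verbatim, literature as printed with
locators, evidence plan with the pre-registered falsifier F-S2 and its kit job, novelty, odds).

HONEST FRAMING. What this file IS: a FORMULATION — one `@[conjecture] def O6WildThreePart : Prop`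
(nothing asserted: no `axiom`, no `sorry`, no `_holds` theorem) plus three sorry-free BOOKKEEPING
lemmas that certify it is an AGREEMENT RECORD with the b2b residual cell's converged O6 targets and
not a rival formulation. What it is NOT: not a theorem about BSD, not a uniform result, not a summit
claim, not a Literature fact; no census number moves; the pre-registered computation attached to it
is EVIDENCE about a finite-layer analytic shadow, never a proof of anything here.

THE POCKET (b2b census, verbatim). Class O6 = "`X3 ∪ X4`, WILD `p = 3` (`v₃(N) ∈ {3,4,5}`)", ranks
`0 / 1`, MARK OPEN, exact missing input "nothing formulated (tame theory only); r0 ∧ X4 upper half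
via Kato 14.5 (3) when tower-surjective", shape "formulate", S-b pairs "X4 60 568 (55 220 / 5 348) ·
X3 18 852 (9 476 / 9 376)" (RESIDUAL-MAP §I row O6); Kraus sub-partition O6-cyc `16 982` (of which
`(G₉)` `8 623`) / O6-dic `62 438`, total `79 420` (CLASS-OWNERS row O6). In the tree the class
predicate is `Rank1Residual.Additive.ClassO6 W p := p ≠ 2 ∧ Addv W p ∧ SubW W p`
(`SubW := ¬ PotMult ∧ ¬ CondExpTwo`, i.e. `ord₃ j ≥ 0 ∧ f₃ ≠ 2`; then `p = 3`, `ClassO6.p_eq_three`),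
used below VERBATIM (no re-definition).

THE STATEMENT (words). "The `3`-part of BSD on pocket O6, in the shape the pocket's two converged
input conjectures deliver it":
* (rank 0 — the face of T-O6-A = KMC₃) for every globally minimal `E/ℚ` of analytic rank `0` that is
  O6 at `3`, `ord₃ #Ш_an(E) ≤ ord₃ #Ш(E)` (`MissingLowerBoundAt W 3`) — the `T = 0` shadow of Kato's
  Main Conjecture 12.10 for `(f_E, 3)` read as an equality (the `≥`/upper half is Kato's Thm. 14.5 (3)
  under (12.5.2), a kernel theorem of the b2b cell under explicit hypotheses; so on those rows this
  conjunct is exactly what is missing for `MissingPPartAt W 3`, lemma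
  `missingPPartAt_three_of_o6WildThreePart_of_upper`);
* (rank 1 — T-O6-C⁺) `Rank1Residual.AdditiveThree.RKC3Divisibility`, cited BY NAME: the divisibility
  half of the refined Kolyvagin conjecture at an additive `3` (every Kolyvagin class `3^t`-divisible,
  `t = ord₃ ∏ c_q`), which with Kolyvagin's structure theorem and Gross–Zagier bookkeeping is the
  rank-one `3`-part route of the pocket (b2b `Additive/WildThreeRefinedKolyvagin.lean`).

AGREEMENT, NOT SUPERSESSION (lead PLAN row ui-o6: "AGREE with b2b's converged T-O6-A = KMC₃ /
T-O6-C⁺ = `AdditiveThree.RKC3Divisibility` or supersede explicitly — never re-file"). T-O6-A is typed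
over an INTERFACE (`O6.LowerHalfRankZeroOfKMC KMC`, `O6/O6Targets.lean`; Kato's Conj. 12.10 itself is
not closed-typeable in the tree — no `𝐇^q(T)`, `Z(f,T)`, Coleman map), so the rank-0 conjunct here is
its CLOSED BSD-facing face restricted to the class predicate; lemma
`o6WildThreePart_left_of_potGoodLowerHalfRankZero` proves the rank-0 conjunct FOLLOWS from the
cell's already-typed conjecture `Additive.PotGoodLowerHalfRankZero` (p249522), the rank-1 conjunct IS
`RKC3Divisibility` (p251003) by name, and lemma `o6WildThreePart_left_of_o6Sharp` proves the rank-0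
conjunct follows from the pocket's BSD-facing conjecture `Additive.O6Sharp`. Nothing of b2b's is re-filed: both conjuncts are
the tree's declarations or their verbatim restriction to `ClassO6 W 3`.

NEAREST IN PRINT (as printed; locators in the companion note §2). Kato, Astérisque 295 (2004),
Conj. 12.10 p. 224 (main conjecture for `(f, p)` with NO reduction hypothesis) and Thm. 14.5 (3)
p. 236–237 (the `#H²`-bound, i.e. the upper half, under (12.5.2)); Delbourgo, Compositio 113 (1998)
p. 152 ("the method presented here cannot cope" outside potentially ordinary type (G)); Jetchev 2008
Conj. 1.3 / W. Zhang 2014 Thm. 1.1 (refined Kolyvagin, printed for `p ∤ N`); C.-H. Kim,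
arXiv:2203.12159 §1.2.5 (`p = 3` "seems possible" — a conjecture in print, ADVISORY A4) and
arXiv:2505.09121 Cor. 1.10 (`p² ∤ N`, so silent on O6); Lei–Pollack–Pratap arXiv:2412.16629 Lemma 5.1
(Mazur–Tate `λ ≥ p^{n−1}` at additive `a_p = 0`) and §4.3 ("eluded us"); Kurihara, Invent. 149 (2002)
Thm. 0.1 (the good-supersingular unit pattern the falsifier transports). Nobody prints the lower
half at a potentially supersingular WILD prime: the statement is a CONJECTURE.

EVIDENCE PLAN (companion note §4). Honest scope first: on `3`-UNIT rank-0 rows (`3 ∤ #tors·∏c·#Ш_an`)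
the rank-0 conjunct is content-free over `ℚ` (`ord₃ #Ш_an = 0`), so a computation there tests the conjecture's
finite-layer ANALYTIC SHADOW (the Mazur–Tate `(μ, λ)` pattern that "KMC₃ as an equality + exactness" predicts,
b2b instrument T-O6-D / law S2), not the conjunct itself; the conjunct has content only on rows with
`3 ∣ #Ш_an`, where it predicts `#Ш[3^∞] ≥ 3^{ord₃ #Ш_an}` (testable by `3`-descent, registered for the review).
Pre-registered falsifier F-S2 = Mazur–Tate `(μ, λ)(θ_k)` at levels `27, 81, 243` on HELD-OUT O6 Kodaira-IV*
`LocIrr` rank-0 curves outside every b2b validation table, independent GP implementation, predictions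
registered BEFORE each run (`pub/bsd-uniform/ui/evidence-o6/PREREG-*.md`, `SHA256SUMS`): batches 1–2
(unit rows: `5481b1`, `5535d1`, `5076a1`, kit `j170867`; V24 = the 24 smallest with `5000 < N ≤ 9018`, kit
`j171018`) — `μ = 0`, `λ(θ_k) = ⌊3^{k+1}/4⌋ = 6, 20, 60` on 25/25 `LocIrr` instances as predicted (the two
non-`LocIrr` rows show `λ = φ(3^k)`); batch 3 = T24 (the NON-unit direction of the unit criterion: 24
held-out rows with `3 ∣ ∏c`, `5535 ≤ N ≤ 10260`, kit `j171616`) and batch 3S = S4 (four held-out CONTENT rows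
with `9 ∣ #Ш_an`: `43200kh1`, `54621s1`, `70011a1`, `85995ca1`, kit `j171642`), predictions `μ = 0`,
`λ(θ_k) − q_k ≥ 2` and even — outcomes tallied in the companion note §4 by the registered kill/read rule;
CORE-row `3`-descent (`dim Sel₃ = 2` on 24 named rows) and rank-1 Kolyvagin-class divisibility (1 329 named
rows) registered for the review date with b2b's instruments. A failed prediction is reported as such.
-/

namespace Summit.BirchSwinnertonDyer.Uniform.UI

open Summit.BirchSwinnertonDyer.Rank1Residual.Additive
open Summit.BirchSwinnertonDyer.Rank1Residual.AdditiveThree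
open Literature.NumberTheory.EllipticCurves.Rank1Residual.Typed

/-- **UI-O6 — the conjectural `3`-part statement for pocket O6 (wild additive reduction at `3`)**, in
the converged two-slot shape of the b2b residual cell: (rank 0) the LOWER half
`ord₃ #Ш_an ≤ ord₃ #Ш` for every globally minimal `E/ℚ` of analytic rank `0` with `ClassO6 E 3`
(= the closed face of T-O6-A = KMC₃, Kato Conj. 12.10 at `T = 0`; the upper half is Kato's
Thm. 14.5 (3)); (rank 1) T-O6-C⁺ = `RKC3Divisibility` by name (refined-Kolyvagin divisibility at an
additive `3`). A CONJECTURE — OPEN, nothing asserted, never a Literature fact; implied by the cell's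
typed conjectures `PotGoodLowerHalfRankZero ∧ RKC3Divisibility`
(`o6WildThreePart_left_of_potGoodLowerHalfRankZero`; the right conjunct is that declaration). Evidence plan and pre-registered falsifier:
`pub/bsd-uniform/ui/O6-CONJECTURE.md` §4.
[cite: Kato2004Asterisque, Conj. 12.10 (p. 224); Thm. 14.5 (3) (pp. 236–237)]
[cite: Jetchev2008, Conj. 1.3 (p. 3)] -/
@[conjecture] def O6WildThreePart : Prop :=
  (∀ (W : WeierstrassCurve ℚ) [W.IsElliptic] [W.IsGloballyMinimal],
      W.analyticRank = 0 → ClassO6 W 3 → MissingLowerBoundAt W 3) ∧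
  RKC3Divisibility

/-- **Agreement certificate 1**: the rank-`0` conjunct FOLLOWS from the b2b cell's typed conjecture
`PotGoodLowerHalfRankZero` (the uniform potentially-good lower half at odd additive primes, all cells
(G-ord)/(G)∧ss/(t′)/(w)) restricted to the wild class; the rank-`1` conjunct IS the cell's
`RKC3Divisibility` by name (definitionally: `O6WildThreePart.2`). Pure bookkeeping
(`ClassO6 ⇒ p ≠ 2 ∧ Addv ∧ ord₃ j ≥ 0`); stated on the conjunct, so no theorem here has the
conjecture itself as its head. [folklore] -/
theorem o6WildThreePart_left_of_potGoodLowerHalfRankZero (hlow : PotGoodLowerHalfRankZero) :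
    ∀ (W : WeierstrassCurve ℚ) [W.IsElliptic] [W.IsGloballyMinimal],
      W.analyticRank = 0 → ClassO6 W 3 → MissingLowerBoundAt W 3 :=
  fun W _ _ hr hO6 ↦ hlow W 3 hr hO6.1 hO6.2.1 (ClassO6.padicValRat_j_nonneg hO6)

/-- **Agreement certificate 2**: the rank-`0` conjunct follows from the pocket's BSD-facing
conjecture `O6Sharp` (`ord₃ #Ш = ord₃ #Ш_an` on every O6 pair of analytic rank `≤ 1`). [folklore] -/
theorem o6WildThreePart_left_of_o6Sharp (h : O6Sharp) :
    ∀ (W : WeierstrassCurve ℚ) [W.IsElliptic] [W.IsGloballyMinimal],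
      W.analyticRank = 0 → ClassO6 W 3 → MissingLowerBoundAt W 3 :=
  fun W _ _ hr hO6 ↦ (lower_and_upper_of_missingPPartAt W 3 (h W 3 (by omega) hO6)).1

/-- **What the rank-`0` conjunct buys**: together with the UPPER half `ord₃ #Ш ≤ ord₃ #Ш_an` (in print:
Kato Thm. 14.5 (3) under (12.5.2); in the b2b kernel under explicit hypotheses) it is the full
`3`-part output `MissingPPartAt W 3` on the rank-`0` O6 rows. Bookkeeping. [folklore] -/
theorem missingPPartAt_three_of_o6WildThreePart_of_upper (h : O6WildThreePart)
    (W : WeierstrassCurve ℚ) [W.IsElliptic] [W.IsGloballyMinimal] (hr : W.analyticRank = 0)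
    (hO6 : ClassO6 W 3) (hup : MissingUpperBoundAt W 3) : MissingPPartAt W 3 :=
  missingPPartAt_of_lower_of_upper W 3 (h.1 W hr hO6) hup

end Summit.BirchSwinnertonDyer.Uniform.UI
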